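import Summits.BirchSwinnertonDyer.BirchSwinnertonDyer.Theses.SignedBalanceX9

/-!
# SignedBalanceX9 — glue of the split of `FourTermDefectUpperX9` (stmt-24709 `UpperOfSplit`)

The split (route rev 4) of the one-sided four-term inequality `FourTermDefectUpperX9` (stmt-24566)
into crux A `HowardContainmentAnyClassNumber` (shared item stmt-23161 of PrintX9 /
TorsionLayerDescent) and the print-and-memo two-variable passage `UpperOfHowardContainment`
(stmt-24708) glues by modus ponens. No summit is proved here; BSD is not proved.
-/

namespace Summit.BirchSwinnertonDyer.BirchSwinnertonDyer.Rank1Residual.SignedBalanceSplit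

open Summit.BirchSwinnertonDyer.BirchSwinnertonDyer.Theses.SignedBalanceX9

/-- The glue `HowardContainmentAnyClassNumber → UpperOfHowardContainment → FourTermDefectUpperX9`. -/
theorem signedBalanceX9_upperOfSplit : UpperOfSplit :=
  fun hA hU => hU hA

/-- by-name link for the ledger item stmt-BirchSwinnertonDyer-24709. -/
theorem upperOfSplit_holds :
    Summit.BirchSwinnertonDyer.BirchSwinnertonDyer.Theses.SignedBalanceX9.UpperOfSplit :=
  signedBalanceX9_upperOfSplit

end Summit.BirchSwinnertonDyer.BirchSwinnertonDyer.Rank1Residual.SignedBalanceSplit
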